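import Summits.ABC.IUTFork.Conditional.AbcOfCor312SlackRecut
import Summits.ABC.IUTFork.Conditional.AbcOfCor312SlackWindow
import HarnessLib

/-!
# The Σ-VARIANT INSIDE THE (P1) WINDOW, RECUT (rh-lead RULING R14 (3)): the window / ρ-relative / full-window abc-ends of p473109–p474672
# with all binders CUT TO THE SZPIRO-BAD LOCUS and the cone binder `hreg ↦ hregBad` (p452637 VERBATIM)

PROOF-ONLY sequel (no `def`, no new `Prop`, no instance, no notation; nothing re-typed) of this seat's `Conditional/AbcOfCor312SlackRecut.lean` (p476943:
`hullEstimateOf_BIII_of_offRegime`) and `Conditional/AbcOfCor312SlackWindow.lean` (p473109 / p474672: `gap_le_window`, the window chain over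
`Literature/IUT/LogVolume/Corollary22PartIIDisplayWindow.lean`'s `Cor22.exists_partII_of_displayWindow` — [IUTchIV] Cor. 2.2 (ii) consumes Thm. 1.10's
display only at the (P1)–(P3) prime `log(q^∀)^{1/2} ≤ l ≤ 10δ_d·log(q^∀)^{1/2}·log(2δ_d·log(q^∀))` and only for `log(q^∀) > 2^140`). abc-iut-rh2-q2-cond gen 2.
TAKES NO SIDE on [IUTchIII] Cor. 3.12 or on any author.

WHY. `ABC_of_cor312Slack_window_of_hullRegime`, `ABC_of_cor312Slack_rho_of_hullRegime` (p473109) and `ABC_of_cor312Slack_windowFull_of_hullRegime`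
(p474672) carry the BLANKET cone binder `hreg`, KERNEL-REFUTED as typed by `Conditional.not_hreg_v4` (p453135): composition records, VACUOUS AS TYPED in
[CONE] (R14 (1)). Here each is re-derived with [NUMΣ-W] / [TOL-W] additionally cut to the SZPIRO-BAD admissible `(P, l)` (antecedent of abc-iut-c312-d1's
`Cor22.forall_cor312Of_of_szpiroBad`, inserted after (P6) and before the window facts) and [CONE] = `hregBad` of abc-iut-C-cert-2's
`Conditional.abc_of_SH_orNum_K_szpiroBad_hregBad` (p452637) VERBATIM. Per window point the proof splits on the CONTENT locus of the display
(abc-iut-C-cert-1's `display_of_not_content` / `szpiroBad_of_content`), so NOTHING is assumed at any admissible `(P, l)` with `log q^{∤{2,l}}(λ) ≤ 120·d*_mod·l`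
— nor anywhere outside the window. The window arithmetic (`gap_le_window`, `display_of_squeezeIII_slack_of_le_sharp`, `five_le_sharpCoeff`) is reused BY
NAME (R14 (2)); no number moves: the «no loss at all» bin stays `ρ = E_off⁺/gap ≤ 30·d*_mod/l = 16 588 800·d_mod/l`.

WHAT IS TYPED (`d* = 2^{12}·3^3·5·d_mod`, `c♯(l) = 20·(1 − 12/l²) − 84/9`, `h = log(q^∀(P))`, `gap(T) = ((l+1)/24 − 1/(2l))·log(q^{∤{2,l}})`):
* **`ABC_of_cor312Slack_window_szpiroBad_hregBad`** — [NUMΣ-W-bad] the weakened Corollary `T.negAbsLogQ ≤ T.negLogTheta + ε P l T` ONLY at Szpiro-bad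
  admissible `(P, l)` with `2^140 < h`, `√h ≤ l` · [TOL♯-W-bad] `ε ≤ ((l+1)/4)·c♯(l)·d*·l` there · [CONE-bad] `hregBad` ⟹ `ABC` (print's constants);
* **`ABC_of_cor312Slack_rho_szpiroBad_hregBad`** — the same with the RELATIVE tolerance [TOL-ρ-W-bad] `ε ≤ (30·d*/l)·gap(T)`;
* **`ABC_of_cor312Slack_windowFull_szpiroBad_hregBad`** — the FULL two-sided (P1) window with the degree bound `d` (`P.degree ≤ d`,
  `√h ≤ l ≤ 10δ_d·√h·log(2δ_d·h)`), Szpiro-bad cut, `hregBad`.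
Binder by binder each theorem is STRONGER-OR-EQUAL than its p473109 / p474672 record (premise drops; `hreg ⟹ hregBad`).

HONEST FRAMING: locates / conditionally verifies; nothing here asserts that abc is proved or refuted, or that [IUTchIII] Cor. 3.12 / Thm. 3.11 or
[IUTchIV] Thm. 1.10 holds or fails at any datum, or takes a side on any author (Mochizuki / Scholze–Stix / Joshi / Dupuy–Hilado); `h312wBad` / `hTol…` /
`hρBad` / `hregBad` are ASSUMPTION LABELS, never asserted; «`ABC` follows from these hypotheses AS TYPED», nothing more; typed ≠ proved; instantiated ≠
endorsed; refuted-as-typed ≠ refuted-in-print. [cite: Mochizuki2012, IUTchIV Thm. 1.10 pp. 22–31; Cor. 2.2 (ii) pp. 41–48, (P1) p. 45]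
[cite: Mochizuki2012, IUTchIII Cor. 3.12 p. 174] [claim: Mochizuki2012, status: disputed]
-/

noncomputable section

namespace Summit.ABC.IUTFork.Conditional.Cor312Slack

open Literature.IUT.LogVolume Literature.IUT.HodgeTheaters Literature.NumberTheory.DiophantineGeometry.GenEll
open Summit.ABC.ABC.Theorems NumberField IsDedekindDomain

/-- **`abc` FROM THE WEAKENED COROLLARY INSIDE THE (P1) WINDOW, sharp `η`-free tolerance — binders CUT TO THE SZPIRO-BAD LOCUS, cone binder
`hregBad`** (recut of p473109's `ABC_of_cor312Slack_window_of_hullRegime`): [NUMΣ-W-bad] `−|log(q)| ≤ −|log(Θ)| + ε(P,l,T)` at every genuine Θ-volume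
datum of every SZPIRO-BAD admissible `(P, l)` WITH `2^140 < log(q^∀(P))` AND `log(q^∀(P))^{1/2} ≤ l` (ASSUMPTION LABEL) · [TOL♯-W-bad]
`ε(P,l,T) ≤ ((l+1)/4)·(20·(1 − 12/l²) − 84/9)·d*_mod·l` there · [CONE-bad] `hregBad` (p452637 VERBATIM) ⟹ `ABC` with print's constants — via
`Cor22.exists_partII_of_displayWindow` at `η₀` of Prop. 1.6; per window point: off the content locus `display_of_not_content`, on it `szpiroBad_of_content`,
`ThetaPartII.stub_thetaData`, `hullEstimateOf_BIII_of_offRegime`, `logQAvoid_le_of_cor312Slack`, `display_of_squeezeIII_slack_of_le_sharp`; `l ≠ 5` by (P6).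
CONDITIONAL; nothing is asserted about the hypotheses; no side taken. [cite: Mochizuki2012, IUTchIV Cor. 2.2–2.3 pp. 41–55, (P1) p. 45]
[cite: Mochizuki2012, IUTchIII Cor. 3.12 p. 174] [claim: Mochizuki2012, status: disputed] -/
theorem ABC_of_cor312Slack_window_szpiroBad_hregBad
    (ε : ∀ (P : NFPoint) (l : ℕ), Cor22.ThetaVolumeDatumAt P l → ℝ)
    (h312wBad : ∀ P : NFPoint, P ∈ UP → ∀ l : ℕ, l.Prime → 5 ≤ l →
      Cor22.AdmitsCore P → Cor22.CondP2 P l → Cor22.CondP5 P l → Cor22.CondP6 P l →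
      (((l : ℝ) + 5) / 4 < (Cor22.dmod P : ℝ) ∨
        6 * l * (((l : ℝ) + 5) - 4 * Cor22.dmod P) / (((l : ℝ) + 4) * ((l : ℝ) - 3))
            * (P.logDiff + (1 - 1 / (l : ℝ)) * Cor22.logCondAvoid P {2, l})
          + 6 * l * ((l : ℝ) + 5) / (((l : ℝ) + 4) * ((l : ℝ) - 3)) * Real.log Real.pi < Cor22.logQAvoid P {2, l}) →
      (2 : ℝ) ^ 140 < Cor22.logQForall P → Real.sqrt (Cor22.logQForall P) ≤ l →
      ∀ T : Cor22.ThetaVolumeDatumAt P l, T.negAbsLogQ ≤ T.negLogTheta + ε P l T)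
    (hTolwBad : ∀ P : NFPoint, P ∈ UP → ∀ l : ℕ, l.Prime → 5 ≤ l →
      Cor22.AdmitsCore P → Cor22.CondP2 P l → Cor22.CondP5 P l → Cor22.CondP6 P l →
      (((l : ℝ) + 5) / 4 < (Cor22.dmod P : ℝ) ∨
        6 * l * (((l : ℝ) + 5) - 4 * Cor22.dmod P) / (((l : ℝ) + 4) * ((l : ℝ) - 3))
            * (P.logDiff + (1 - 1 / (l : ℝ)) * Cor22.logCondAvoid P {2, l})
          + 6 * l * ((l : ℝ) + 5) / (((l : ℝ) + 4) * ((l : ℝ) - 3)) * Real.log Real.pi < Cor22.logQAvoid P {2, l}) →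
      (2 : ℝ) ^ 140 < Cor22.logQForall P → Real.sqrt (Cor22.logQForall P) ≤ l →
      ∀ T : Cor22.ThetaVolumeDatumAt P l,
        ε P l T ≤ ((l : ℝ) + 1) / 4 * ((20 * (1 - 12 / (l : ℝ) ^ 2) - 84 / 9) * ((((2 ^ 12 * 3 ^ 3 * 5 * Cor22.dmod P : ℕ) : ℝ)) * l)))
    (hregBad : ∀ P : NFPoint, P ∈ UP → ∀ l : ℕ, l.Prime → 5 ≤ l →
      Cor22.AdmitsCore P → Cor22.CondP2 P l → Cor22.CondP5 P l → Cor22.CondP6 P l →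
      (((l : ℝ) + 5) / 4 < (Cor22.dmod P : ℝ) ∨
        6 * l * (((l : ℝ) + 5) - 4 * Cor22.dmod P) / (((l : ℝ) + 4) * ((l : ℝ) - 3))
            * (P.logDiff + (1 - 1 / (l : ℝ)) * Cor22.logCondAvoid P {2, l})
          + 6 * l * ((l : ℝ) + 5) / (((l : ℝ) + 4) * ((l : ℝ) - 3)) * Real.log Real.pi < Cor22.logQAvoid P {2, l}) →
      ∀ T : Cor22.ThetaVolumeDatumAt P l,
        (letI := T.instFieldF; letI := T.instNumberFieldF; letI := T.instAlgebraF; letI := T.instFieldK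
         letI := T.instNumberFieldK; letI := T.instAlgebraK; letI := T.instFieldFbar; letI := T.instAlgebraFbar
         letI := T.instAlgebraKFbar; letI := T.instIsElliptic
         ¬ (∀ p ∈ T.I.supportPrimes, ∀ v w : placesOver (fieldOfModuli T.E) p,
            (Summit.ABC.IUTFork.DHData.ofInput T.I).logQloc p v = (Summit.ABC.IUTFork.DHData.ofInput T.I).logQloc p w)) →
        T.HullEstimateOf
          (((l : ℝ) + 1) / 4 *
            ((1 + 12 * (Cor22.dmod P : ℝ) / l) * (P.logDiff + Cor22.logCondAvoid P {2, l})
              + 2 * Real.log l + 52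
              + 20 / 3 * Real.log (((2 ^ 12 * 3 ^ 3 * 5 * Cor22.dmod P : ℕ) : ℝ) * (l : ℝ))
                * (Nat.primeCounting (2 ^ 12 * 3 ^ 3 * 5 * Cor22.dmod P * l) : ℝ))))
    : _root_.ABC := by
  obtain ⟨η₀, hη₀⟩ := exists_isEtaPrm
  refine Summit.ABC.ABC.Theses.IUTThetaPilot.closes ?_ Summit.ABC.ABC.Theorems.genEllTwo_holds Summit.ABC.ABC.Theorems.JInvWlog_proof
  unfold Summit.ABC.ABC.Theses.IUTThetaPilot.ThetaPartII
  refine Cor22.exists_partII_of_displayWindow hη₀ (fun P hP d _ l hl h5 hcore hP2 hP5 h6 h140 hlo _ => ?_) Cor22.fullGaloisImage_holds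
  have hη0 : 0 < η₀ := hη₀.1
  by_cases hct : 6 * ((1 + 20 * (Cor22.dmod P : ℝ) / l) * (P.logDiff + Cor22.logCondAvoid P {2, l}))
        + 120 * (2 ^ 12 * 3 ^ 3 * 5 * (Cor22.dmod P : ℝ) * l) < Cor22.logQAvoid P {2, l}
  swap
  · exact display_of_not_content hη0 hct
  have hbad := szpiroBad_of_content h5 hct
  have h7 : 7 ≤ l := ThetaPartII.seven_le_of_condP6 hP hl h5 h6
  have hne : l ≠ 5 := by omega
  have hl7 : (7 : ℝ) ≤ l := by exact_mod_cast h7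
  obtain ⟨T⟩ := ThetaPartII.stub_thetaData P hP l hl h5 hcore hP2 hP5 h6
  have hgap := logQAvoid_le_of_cor312Slack T hP.1 (h312wBad P hP l hl h5 hcore hP2 hP5 h6 hbad h140 hlo T)
    (hullEstimateOf_BIII_of_offRegime hP hl h5 hcore hP2 hP5 h6 T (hregBad P hP l hl h5 hcore hP2 hP5 h6 hbad T))
  refine display_of_squeezeIII_slack_of_le_sharp hl h5 hne hη₀ le_rfl
    (le_trans (hTolwBad P hP l hl h5 hcore hP2 hP5 h6 hbad h140 hlo T) ?_) hgap
  have hc : (0 : ℝ) ≤ ((l : ℝ) + 1) / 4 := by positivity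
  have hcS : (0 : ℝ) ≤ 20 * (1 - 12 / (l : ℝ) ^ 2) - 84 / 9 := le_trans (by norm_num) (five_le_sharpCoeff hl7)
  exact mul_le_mul_of_nonneg_left (mul_le_mul_of_nonneg_left (by linarith) hcS) hc

/-- **`abc` FROM THE WEAKENED COROLLARY INSIDE THE (P1) WINDOW with the RELATIVE tolerance `ρ(P,l) = 30·d*_mod/l` — binders CUT TO THE
SZPIRO-BAD LOCUS, cone binder `hregBad`** (recut of p473109's `ABC_of_cor312Slack_rho_of_hullRegime`): [NUMΣ-W-bad] as above · [TOL-ρ-W-bad]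
`ε(P,l,T) ≤ (30·d*/l)·gap(T)` at Szpiro-bad admissible `(P, l)` with `2^140 < log(q^∀)`, `log(q^∀)^{1/2} ≤ l` · [CONE-bad] `hregBad` ⟹ `ABC` with print's
constants: inside the window `(30·d*/l)·gap(T) ≤ ((l+1)/4)·5·d*·l ≤ Tol♯` (`gap_le_window`, `five_le_sharpCoeff`). The relative error class
«`ρ ≤ 16 588 800·d_mod/l`» is absorbed with NO loss. CONDITIONAL; nothing is asserted about the hypotheses; no side taken.
[cite: Mochizuki2012, IUTchIV Cor. 2.2–2.3 pp. 41–55, (P1) p. 45] [cite: Mochizuki2012, IUTchIII Cor. 3.12 p. 174] [claim: Mochizuki2012, status: disputed] -/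
theorem ABC_of_cor312Slack_rho_szpiroBad_hregBad
    (ε : ∀ (P : NFPoint) (l : ℕ), Cor22.ThetaVolumeDatumAt P l → ℝ)
    (h312wBad : ∀ P : NFPoint, P ∈ UP → ∀ l : ℕ, l.Prime → 5 ≤ l →
      Cor22.AdmitsCore P → Cor22.CondP2 P l → Cor22.CondP5 P l → Cor22.CondP6 P l →
      (((l : ℝ) + 5) / 4 < (Cor22.dmod P : ℝ) ∨
        6 * l * (((l : ℝ) + 5) - 4 * Cor22.dmod P) / (((l : ℝ) + 4) * ((l : ℝ) - 3))
            * (P.logDiff + (1 - 1 / (l : ℝ)) * Cor22.logCondAvoid P {2, l})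
          + 6 * l * ((l : ℝ) + 5) / (((l : ℝ) + 4) * ((l : ℝ) - 3)) * Real.log Real.pi < Cor22.logQAvoid P {2, l}) →
      (2 : ℝ) ^ 140 < Cor22.logQForall P → Real.sqrt (Cor22.logQForall P) ≤ l →
      ∀ T : Cor22.ThetaVolumeDatumAt P l, T.negAbsLogQ ≤ T.negLogTheta + ε P l T)
    (hρBad : ∀ P : NFPoint, P ∈ UP → ∀ l : ℕ, l.Prime → 5 ≤ l →
      Cor22.AdmitsCore P → Cor22.CondP2 P l → Cor22.CondP5 P l → Cor22.CondP6 P l →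
      (((l : ℝ) + 5) / 4 < (Cor22.dmod P : ℝ) ∨
        6 * l * (((l : ℝ) + 5) - 4 * Cor22.dmod P) / (((l : ℝ) + 4) * ((l : ℝ) - 3))
            * (P.logDiff + (1 - 1 / (l : ℝ)) * Cor22.logCondAvoid P {2, l})
          + 6 * l * ((l : ℝ) + 5) / (((l : ℝ) + 4) * ((l : ℝ) - 3)) * Real.log Real.pi < Cor22.logQAvoid P {2, l}) →
      (2 : ℝ) ^ 140 < Cor22.logQForall P → Real.sqrt (Cor22.logQForall P) ≤ l →
      ∀ T : Cor22.ThetaVolumeDatumAt P l,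
        ε P l T ≤ 30 * (((2 ^ 12 * 3 ^ 3 * 5 * Cor22.dmod P : ℕ) : ℝ)) / l * T.gap)
    (hregBad : ∀ P : NFPoint, P ∈ UP → ∀ l : ℕ, l.Prime → 5 ≤ l →
      Cor22.AdmitsCore P → Cor22.CondP2 P l → Cor22.CondP5 P l → Cor22.CondP6 P l →
      (((l : ℝ) + 5) / 4 < (Cor22.dmod P : ℝ) ∨
        6 * l * (((l : ℝ) + 5) - 4 * Cor22.dmod P) / (((l : ℝ) + 4) * ((l : ℝ) - 3))
            * (P.logDiff + (1 - 1 / (l : ℝ)) * Cor22.logCondAvoid P {2, l})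
          + 6 * l * ((l : ℝ) + 5) / (((l : ℝ) + 4) * ((l : ℝ) - 3)) * Real.log Real.pi < Cor22.logQAvoid P {2, l}) →
      ∀ T : Cor22.ThetaVolumeDatumAt P l,
        (letI := T.instFieldF; letI := T.instNumberFieldF; letI := T.instAlgebraF; letI := T.instFieldK
         letI := T.instNumberFieldK; letI := T.instAlgebraK; letI := T.instFieldFbar; letI := T.instAlgebraFbar
         letI := T.instAlgebraKFbar; letI := T.instIsElliptic
         ¬ (∀ p ∈ T.I.supportPrimes, ∀ v w : placesOver (fieldOfModuli T.E) p,
            (Summit.ABC.IUTFork.DHData.ofInput T.I).logQloc p v = (Summit.ABC.IUTFork.DHData.ofInput T.I).logQloc p w)) →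
        T.HullEstimateOf
          (((l : ℝ) + 1) / 4 *
            ((1 + 12 * (Cor22.dmod P : ℝ) / l) * (P.logDiff + Cor22.logCondAvoid P {2, l})
              + 2 * Real.log l + 52
              + 20 / 3 * Real.log (((2 ^ 12 * 3 ^ 3 * 5 * Cor22.dmod P : ℕ) : ℝ) * (l : ℝ))
                * (Nat.primeCounting (2 ^ 12 * 3 ^ 3 * 5 * Cor22.dmod P * l) : ℝ))))
    : _root_.ABC := by
  refine ABC_of_cor312Slack_window_szpiroBad_hregBad ε h312wBad (fun P hP l hl h5 hcore hP2 hP5 h6 hbad h140 hlo T => ?_) hregBad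
  have hU : P.InU := hP.1
  have hl7 : (7 : ℝ) ≤ l := by exact_mod_cast ThetaPartII.seven_le_of_condP6 hP hl h5 h6
  have hl0 : (0 : ℝ) < l := by linarith
  have hD0 : (0 : ℝ) ≤ (((2 ^ 12 * 3 ^ 3 * 5 * Cor22.dmod P : ℕ) : ℝ)) := Nat.cast_nonneg _
  have hg := gap_le_window T hU hlo
  have hκ0 : (0 : ℝ) ≤ 30 * (((2 ^ 12 * 3 ^ 3 * 5 * Cor22.dmod P : ℕ) : ℝ)) / l := by positivity
  refine le_trans (hρBad P hP l hl h5 hcore hP2 hP5 h6 hbad h140 hlo T) ?_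
  calc 30 * (((2 ^ 12 * 3 ^ 3 * 5 * Cor22.dmod P : ℕ) : ℝ)) / l * T.gap
      ≤ 30 * (((2 ^ 12 * 3 ^ 3 * 5 * Cor22.dmod P : ℕ) : ℝ)) / l * (((l : ℝ) + 1) / 24 * (l : ℝ) ^ 2) := mul_le_mul_of_nonneg_left hg hκ0
    _ = ((l : ℝ) + 1) / 4 * (5 * ((((2 ^ 12 * 3 ^ 3 * 5 * Cor22.dmod P : ℕ) : ℝ)) * l)) := by
        field_simp
        ring
    _ ≤ ((l : ℝ) + 1) / 4 * ((20 * (1 - 12 / (l : ℝ) ^ 2) - 84 / 9) * ((((2 ^ 12 * 3 ^ 3 * 5 * Cor22.dmod P : ℕ) : ℝ)) * l)) := by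
        have hc : (0 : ℝ) ≤ ((l : ℝ) + 1) / 4 := by positivity
        have hDl : (0 : ℝ) ≤ (((2 ^ 12 * 3 ^ 3 * 5 * Cor22.dmod P : ℕ) : ℝ)) * l := by positivity
        exact mul_le_mul_of_nonneg_left (mul_le_mul_of_nonneg_right (five_le_sharpCoeff hl7) hDl) hc

/-- **`abc` from the weakened Corollary demanded EXACTLY where [IUTchIV] Cor. 2.2 (ii) applies Thm. 1.10 — the FULL (P1) window with the degree
bound `d` — binders CUT TO THE SZPIRO-BAD LOCUS, cone binder `hregBad`** (recut of p474672's `ABC_of_cor312Slack_windowFull_of_hullRegime`):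
[NUMΣ-W′-bad] `−|log(q)| ≤ −|log(Θ)| + ε(P,l,T)` at Szpiro-bad admissible `(P, l)` with `P.degree ≤ d`, `2^140 < log(q^∀(P))`,
`log(q^∀(P))^{1/2} ≤ l ≤ 10δ_d·log(q^∀(P))^{1/2}·log(2δ_d·log(q^∀(P)))` (`δ_d = Cor22.delta d`) · [TOL♯-W′-bad] `ε ≤ ((l+1)/4)·c♯(l)·d*·l` there · [CONE-bad]
`hregBad` ⟹ `ABC` with print's constants (`Cor22.exists_partII_of_displayWindow` with all three window facts). CONDITIONAL; nothing is asserted about the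
hypotheses; no side taken. [cite: Mochizuki2012, IUTchIV Cor. 2.2 (ii) pp. 41–48, (P1) p. 45] [cite: Mochizuki2012, IUTchIII Cor. 3.12 p. 174]
[claim: Mochizuki2012, status: disputed] -/
theorem ABC_of_cor312Slack_windowFull_szpiroBad_hregBad
    (ε : ∀ (P : NFPoint) (l : ℕ), Cor22.ThetaVolumeDatumAt P l → ℝ)
    (h312wBad : ∀ P : NFPoint, P ∈ UP → ∀ d : ℕ, P.degree ≤ d → ∀ l : ℕ, l.Prime → 5 ≤ l →
      Cor22.AdmitsCore P → Cor22.CondP2 P l → Cor22.CondP5 P l → Cor22.CondP6 P l →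
      (((l : ℝ) + 5) / 4 < (Cor22.dmod P : ℝ) ∨
        6 * l * (((l : ℝ) + 5) - 4 * Cor22.dmod P) / (((l : ℝ) + 4) * ((l : ℝ) - 3))
            * (P.logDiff + (1 - 1 / (l : ℝ)) * Cor22.logCondAvoid P {2, l})
          + 6 * l * ((l : ℝ) + 5) / (((l : ℝ) + 4) * ((l : ℝ) - 3)) * Real.log Real.pi < Cor22.logQAvoid P {2, l}) →
      (2 : ℝ) ^ 140 < Cor22.logQForall P → Real.sqrt (Cor22.logQForall P) ≤ l →
      (l : ℝ) ≤ 10 * Cor22.delta d * Real.sqrt (Cor22.logQForall P) * Real.log (2 * Cor22.delta d * Cor22.logQForall P) →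
      ∀ T : Cor22.ThetaVolumeDatumAt P l, T.negAbsLogQ ≤ T.negLogTheta + ε P l T)
    (hTolwBad : ∀ P : NFPoint, P ∈ UP → ∀ d : ℕ, P.degree ≤ d → ∀ l : ℕ, l.Prime → 5 ≤ l →
      Cor22.AdmitsCore P → Cor22.CondP2 P l → Cor22.CondP5 P l → Cor22.CondP6 P l →
      (((l : ℝ) + 5) / 4 < (Cor22.dmod P : ℝ) ∨
        6 * l * (((l : ℝ) + 5) - 4 * Cor22.dmod P) / (((l : ℝ) + 4) * ((l : ℝ) - 3))
            * (P.logDiff + (1 - 1 / (l : ℝ)) * Cor22.logCondAvoid P {2, l})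
          + 6 * l * ((l : ℝ) + 5) / (((l : ℝ) + 4) * ((l : ℝ) - 3)) * Real.log Real.pi < Cor22.logQAvoid P {2, l}) →
      (2 : ℝ) ^ 140 < Cor22.logQForall P → Real.sqrt (Cor22.logQForall P) ≤ l →
      (l : ℝ) ≤ 10 * Cor22.delta d * Real.sqrt (Cor22.logQForall P) * Real.log (2 * Cor22.delta d * Cor22.logQForall P) →
      ∀ T : Cor22.ThetaVolumeDatumAt P l,
        ε P l T ≤ ((l : ℝ) + 1) / 4 * ((20 * (1 - 12 / (l : ℝ) ^ 2) - 84 / 9) * ((((2 ^ 12 * 3 ^ 3 * 5 * Cor22.dmod P : ℕ) : ℝ)) * l)))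
    (hregBad : ∀ P : NFPoint, P ∈ UP → ∀ l : ℕ, l.Prime → 5 ≤ l →
      Cor22.AdmitsCore P → Cor22.CondP2 P l → Cor22.CondP5 P l → Cor22.CondP6 P l →
      (((l : ℝ) + 5) / 4 < (Cor22.dmod P : ℝ) ∨
        6 * l * (((l : ℝ) + 5) - 4 * Cor22.dmod P) / (((l : ℝ) + 4) * ((l : ℝ) - 3))
            * (P.logDiff + (1 - 1 / (l : ℝ)) * Cor22.logCondAvoid P {2, l})
          + 6 * l * ((l : ℝ) + 5) / (((l : ℝ) + 4) * ((l : ℝ) - 3)) * Real.log Real.pi < Cor22.logQAvoid P {2, l}) →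
      ∀ T : Cor22.ThetaVolumeDatumAt P l,
        (letI := T.instFieldF; letI := T.instNumberFieldF; letI := T.instAlgebraF; letI := T.instFieldK
         letI := T.instNumberFieldK; letI := T.instAlgebraK; letI := T.instFieldFbar; letI := T.instAlgebraFbar
         letI := T.instAlgebraKFbar; letI := T.instIsElliptic
         ¬ (∀ p ∈ T.I.supportPrimes, ∀ v w : placesOver (fieldOfModuli T.E) p,
            (Summit.ABC.IUTFork.DHData.ofInput T.I).logQloc p v = (Summit.ABC.IUTFork.DHData.ofInput T.I).logQloc p w)) →
        T.HullEstimateOf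
          (((l : ℝ) + 1) / 4 *
            ((1 + 12 * (Cor22.dmod P : ℝ) / l) * (P.logDiff + Cor22.logCondAvoid P {2, l})
              + 2 * Real.log l + 52
              + 20 / 3 * Real.log (((2 ^ 12 * 3 ^ 3 * 5 * Cor22.dmod P : ℕ) : ℝ) * (l : ℝ))
                * (Nat.primeCounting (2 ^ 12 * 3 ^ 3 * 5 * Cor22.dmod P * l) : ℝ))))
    : _root_.ABC := by
  obtain ⟨η₀, hη₀⟩ := exists_isEtaPrm
  refine Summit.ABC.ABC.Theses.IUTThetaPilot.closes ?_ Summit.ABC.ABC.Theorems.genEllTwo_holds Summit.ABC.ABC.Theorems.JInvWlog_proof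
  unfold Summit.ABC.ABC.Theses.IUTThetaPilot.ThetaPartII
  refine Cor22.exists_partII_of_displayWindow hη₀ (fun P hP d hPd l hl h5 hcore hP2 hP5 h6 h140 hlo hhi => ?_) Cor22.fullGaloisImage_holds
  have hη0 : 0 < η₀ := hη₀.1
  by_cases hct : 6 * ((1 + 20 * (Cor22.dmod P : ℝ) / l) * (P.logDiff + Cor22.logCondAvoid P {2, l}))
        + 120 * (2 ^ 12 * 3 ^ 3 * 5 * (Cor22.dmod P : ℝ) * l) < Cor22.logQAvoid P {2, l}
  swap
  · exact display_of_not_content hη0 hct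
  have hbad := szpiroBad_of_content h5 hct
  have h7 : 7 ≤ l := ThetaPartII.seven_le_of_condP6 hP hl h5 h6
  have hne : l ≠ 5 := by omega
  have hl7 : (7 : ℝ) ≤ l := by exact_mod_cast h7
  obtain ⟨T⟩ := ThetaPartII.stub_thetaData P hP l hl h5 hcore hP2 hP5 h6
  have hgap := logQAvoid_le_of_cor312Slack T hP.1 (h312wBad P hP d hPd l hl h5 hcore hP2 hP5 h6 hbad h140 hlo hhi T)
    (hullEstimateOf_BIII_of_offRegime hP hl h5 hcore hP2 hP5 h6 T (hregBad P hP l hl h5 hcore hP2 hP5 h6 hbad T))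
  refine display_of_squeezeIII_slack_of_le_sharp hl h5 hne hη₀ le_rfl
    (le_trans (hTolwBad P hP d hPd l hl h5 hcore hP2 hP5 h6 hbad h140 hlo hhi T) ?_) hgap
  have hc : (0 : ℝ) ≤ ((l : ℝ) + 1) / 4 := by positivity
  have hcS : (0 : ℝ) ≤ 20 * (1 - 12 / (l : ℝ) ^ 2) - 84 / 9 := le_trans (by norm_num) (five_le_sharpCoeff hl7)
  exact mul_le_mul_of_nonneg_left (mul_le_mul_of_nonneg_left (by linarith) hcS) hc

end Summit.ABC.IUTFork.Conditional.Cor312Slack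

end
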